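import Mathlib.NumberTheory.Cyclotomic.Basic
import Literature.NumberTheory.EllipticCurves.Wuthrich2014.ReducibleDivisibility
import Literature.NumberTheory.EllipticCurves.LangHeightNonarchEstimate
import HarnessLib

/-!
# Delbourgo 1998, Thm. 3 + Prop. 4: the rank-zero algebraic leading term of `X(E/ℚ_∞)` at an UNSTABLE (additive) prime (named fact, weaker than print)

Topic `NumberTheory/EllipticCurves`, sub-directory `Delbourgo1998` (namespace = path). ONE named fact
(`def … : Prop`, D-0014) and nothing else. Written for the residual cell `b2b-bsdres` (classes X3/X4 =
additive `p`; seat additive-p4, chain V9 link [A]; the reading was page-verified and GRANTED by the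
cell's referee as R79.2 (b), REFEREE.md gen 79, for harvest-2's L-I0SQ chain).

## The printed statements (D. Delbourgo, *Iwasawa theory for elliptic curves at unstable primes*,
Compositio Math. 113 (1998) 123–154; held text `paper:delbourgo1998-…`, pages as printed)

* p. 123: "assume `p` denotes an odd rational prime"; `ℚ_∞` = the cyclotomic `ℤ_p`-extension, `Γ = Gal(ℚ_∞/ℚ)`,
  `Λ = ℤ_p⟦Γ⟧ ≅ ℤ_p⟦T⟧` (`γ ↦ 1 + T`, p. 151).
* §2.1 (pp. 136–137): `S(E/ℚ)` and `S(E/ℚ_∞)` are the CLASSICAL Selmer groups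
  (`0 → S(E/ℚ) → H¹(ℚ, E_{p^∞}) → ⊕_q H¹(ℚ_q, E)(p)`), `X_∞ = S(E/ℚ_∞)^∧` their Pontryagin dual.
* §1.5 (p. 130) **Hypothesis (G)**: "`E` has potential good reduction at `p` and `E` possesses good
  reduction over a field `L ⊂ ℚ_p(μ_p)` where `[L : ℚ_p] = d`." §1.6 (p. 133) **Hypothesis (M)**: "`E` has
  potential multiplicative reduction at `p`, and hence `E` possesses (bad) multiplicative reduction over
  a field `L ⊂ ℚ_p(μ_p)` where `[L : ℚ_p] = 1` or `2`" (⇔ `ord_p j_E < 0`, p. 133).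
* §2.3 (p. 143) **Hypothesis (Kol)**: "`E` is modular and its analytic rank `r_E` is zero. … (Kol) implies
  the finiteness of both `E(ℚ)` and the Tate–Shafarevic group [Kolyvagin]."
* **Theorem 3** (p. 143): "Assume that either `E` has potential good ordinary reduction at `p` and
  satisfies (G), or `E` satisfies (M) and does not have split multiplicative reduction at `p`. Moreover
  suppose that `E` satisfies the hypothesis (Kol). Then the module `X_∞` is `Λ`-torsion. If `G_E`
  denotes its characteristic power series then the leading term `x_p^0(G_E) ≠ 0`."
* **Proposition 4** (p. 144): "Assume that either `E` has potential good ordinary reduction at `p` and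
  satisfies (G), or `E` satisfies (M) and does not have split multiplicative reduction at `p`. Again
  suppose that `E` satisfies the hypothesis (Kol). Then
  `x_p^0(G_E) ∼ #Ш_E(p) · #E(ℚ)^{−2} · #H¹(ℚ_{∞,p}/ℚ_p, E(ℚ_{∞,p})) · ∏_{ν ≠ p} c_ν`,
  where `Ш_E` is the Tate–Shafarevic group of `E` over `ℚ`, with `∼` denoting equivalence up to a
  `p`-adic unit." (Lemma of §2.2, pp. 139–140: the `H¹`-factor is `#F(𝔽_p)(p)·#(R E(ℚ_p))(p)` in case (G),
  and `1` in case (M) "and does not have split multiplicative reduction over `ℚ_p`" — the proof treats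
  `E ≅ E^{(δ)}` over a ramified quadratic `F′/ℚ_p`, i.e. every ADDITIVE curve of type (M).)

## The fact below (weaker than print)

* `x_p^0(G_E)` is the value at the trivial character, i.e. the constant term `G_E(0)` of the
  characteristic power series (no zero there by Thm. 3). For an ARBITRARY element `g` of the
  characteristic ideal `char_Λ X_∞ = (G_E)` one has `g = h · G_E`, `h ∈ Λ`, so `g(0) ∈ G_E(0) · ℤ_p`;
  dropping the `p`-adic unit, the cofactor `h(0)`, the factor `#H¹(ℚ_{∞,p}/ℚ_p, E(ℚ_{∞,p}))` (the order
  of a finite group, an INTEGER `≥ 1`) and the prime-to-`p` parts, Prop. 4 yields the DIVISIBILITY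
  `p^{ord_p #Ш_E(p) + ord_p ∏_{ν≠p} c_ν} ∣ g(0) · #E(ℚ)²` in `ℤ_p` — this is what is typed (weaker than
  print; it is the inequality `ord_p #Ш(p) + ord_p ∏_{ν≠p} c_ν − 2 ord_p #E(ℚ) ≤ ord_p g(0)` for `g(0) ≠ 0`).
* Hypotheses, weaker than print: `p ≠ 2`; `E` ADDITIVE at `p` (then "`E` does not have split
  multiplicative reduction at `p`" holds trivially, and (M) is exactly `ord_p j_E < 0`); EITHER
  (G)-ordinary in the global form of the cell (a `p`-th cyclotomic field `L ⊇ ℚ` and an intermediate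
  field `F` over which `E` has good reduction with unit root at every place above `p` — implies
  Delbourgo's local (G) with `L_w = F_w ⊂ ℚ_p(μ_p)` and ordinary reduction; same transcription as the
  accepted `Summit.….Additive.TypeGOrd`) OR `ord_p j_E < 0`; (Kol) as `r_an = 0` (modularity is a
  theorem), PLUS the finiteness of `Ш(E/ℚ)` and of `E(ℚ)` as explicit binders (conclusions of (Kol) in
  the paper; binders here — weaker); `κ` the cyclotomic `ℤ_p`-extension with topological generator `γ`
  and `D : W.SelmerDualData κ γ` the tree's Pontryagin-dual datum of the classical `Sel_{p^∞}(E/ℚ_∞)`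
  (file `IwasawaSelmer`, the same object as Delbourgo's `X_∞`). Conclusion: `D.IsTorsion` (Thm. 3) and
  the divisibility above for every `g ∈ D.charIdeal`, with `∏_{ν≠p} c_ν` the `finprod` of the tree's
  place-indexed `tamagawaNumberAt` away from `p`, `#E(ℚ) = Nat.card W.toAffine.Point`,
  `#Ш_E(p) = Nat.card` of the `p`-primary component of `W.sha`. No `_holds` (size L: Perrin-Riou /
  Coates–Greenberg control at an unstable prime).

## References
* D. Delbourgo, Compositio Math. 113 (1998) 123–154, §1.5 (G), §1.6 (M), §2.1, §2.2 Lemma, Thm. 3,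
  Prop. 4. [Delbourgo1998]
* R. Greenberg, LNM 1716 (1999), §1 (the cyclotomic Iwasawa module; tree `SelmerDualData`). [GreenbergLNM1716]
-/

noncomputable section

open scoped Classical NumberField

open IsDedekindDomain NumberField WeierstrassCurve

namespace Literature.NumberTheory.EllipticCurves.Delbourgo1998

/-- **Delbourgo 1998, Thm. 3 + Prop. 4 (rank-zero leading term at an additive prime), weaker than
print.** Let `W/ℚ` be a globally minimal elliptic curve, `p ≠ 2` a prime of ADDITIVE reduction such that
either (G)-ordinary holds — for some `p`-th cyclotomic field `L ⊇ ℚ` and intermediate field `F`,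
`E_F` has good reduction with unit root (ordinary) at every place of `F` above `p` — or `ord_p j_E < 0`
(hypothesis (M)); assume `r_an(E) = 0` ((Kol)) and, as binders, `Ш(E/ℚ)` and `E(ℚ)` finite. Let `κ`
be the cyclotomic `ℤ_p`-extension of `ℚ`, `γ` a topological generator, and `D` a Pontryagin-dual datum
of `Sel_{p^∞}(E/ℚ_∞)`. Then `X(E/ℚ_∞)` is `Λ`-torsion and, for every `g` in its characteristic ideal,
`p^{ord_p #Ш(E)(p) + ord_p ∏_{ν≠p} c_ν} ∣ g(0) · #E(ℚ)²` in `ℤ_p` (from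
`x_p^0(G_E) ∼ #Ш_E(p)·#E(ℚ)^{−2}·#H¹(ℚ_{∞,p}/ℚ_p, E(ℚ_{∞,p}))·∏_{ν≠p} c_ν`, the `H¹`-factor being a
positive integer and `g ∈ G_E Λ`). Weaker than print. No `_holds`.
[cite: Delbourgo1998, Thm. 3 (p. 143) and Prop. 4 (p. 144), with §1.5 (G) (p. 130), §1.6 (M) (p. 133), §2.1 (p. 136), §2.2 Lemma (pp. 139–140)] -/
def prop4_rankZero_pow_dvd_constantCoeff : Prop :=
  ∀ (W : WeierstrassCurve ℚ) [W.IsElliptic] [W.IsGloballyMinimal] (p : ℕ) [Fact p.Prime],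
    p ≠ 2 →
    (¬ W.HasGoodReductionAtPrime p ∧ ¬ W.HasMultiplicativeReductionAtPrime p) →
    ((∃ (L : Type) (_ : Field L) (_ : NumberField L) (_ : IsCyclotomicExtension {p} ℚ L)
        (F : IntermediateField ℚ L),
        ∀ w : HeightOneSpectrum (𝓞 F), (p : 𝓞 F) ∈ w.asIdeal →
          (W.baseChange F).HasGoodReductionAt w ∧ (W.baseChange F).HasUnitRootAt w) ∨
      padicValRat p W.j < 0) →
    W.analyticRank = 0 → Finite W.sha → Finite W.toAffine.Point →
    ∀ (κ : ZpExtension ℚ p) (γ : Field.absoluteGaloisGroup ℚ),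
      κ.IsCyclotomic → κ.IsTopGenerator γ →
      ∀ D : W.SelmerDualData κ γ,
        D.IsTorsion ∧
        ∀ g ∈ D.charIdeal,
          (p : ℤ_[p]) ^ (padicValNat p (Nat.card (AddCommGroup.primaryComponent W.sha p)) +
              padicValNat p (∏ᶠ v : HeightOneSpectrum (𝓞 ℚ),
                if (p : 𝓞 ℚ) ∈ v.asIdeal then 1 else W.tamagawaNumberAt v)) ∣
            PowerSeries.constantCoeff g * ((Nat.card W.toAffine.Point : ℕ) : ℤ_[p]) ^ 2

end Literature.NumberTheory.EllipticCurves.Delbourgo1998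

end
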